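import Mathlib
import Summits.NavierStokesRegularity.FluidComputer.TransportGalerkinKeepKill
import Summits.NavierStokesRegularity.FluidComputer.ConvectiveProductLawLattice
import Literature.Analysis.FunctionSpaces.LatticeFirstOrderAdjoint
import HarnessLib

/-!
# The transport Galerkin model: the bilinear loss (B) with the `H¹`-level diagonal weight, from the lattice product law (instab g17, cell `ns-blowup`, 2026-08-27)

HONEST FRAMING (human ruling D-0035): nothing here is a claim about Navier–Stokes blow-up.
WHAT THIS IS NOT: not NS evidence — typing residue (r2) of `HOME/instab/INSTAB-BRIDGE.md` l.133:
the hypothesis `(B)` «`√Re⟪D₁ (bilOp x y), bilOp x y⟫ ≤ c_alg ‖x‖ ‖y‖` for all `x, y ∈ E`» of the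
model's KEEP/KILL sentences (`TransportGalerkinKeepKill`) is DISCHARGED for the `H¹`-level diagonal
weight `D₁ = Λ⁻²` (so that `Re⟪D₁ z, z⟫ = ‖Λ⁻² z‖²_{H¹}` in scaled coordinates) with the constant
`c_alg = 2·(card d·2π)·σ`, `σ² = ∑_l ⟨l⟩⁻⁴` (finite iff `card d ≤ 3`; g12's
`ConvectiveProductLawLattice.eNormSq_one_le_of_convective_domination` = the product law
`H²·H² → H¹`, fed by part I's convective domination `TransportCommutatorLattice.enorm_transport_apply_le`;
the Leray symbol is a modewise contraction; junk values of `bilOp` are `0` and satisfy `(B)` trivially).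

* §1 the diagonal weight `Λ⁻²` on `E` exists as a bounded real-linear map (`exists_diagWeight`) and
  its bookkeeping: `P_n`-compatibility, `Re⟪Λ⁻² x, x⟫ = ‖⇑x‖²_{−1} ≥ 0`;
* §2 `bilinear_loss` — `(B)` for `bilOp π P` against `Λ⁻²`;
* §3 `half_prediction_nsField''` / `decay_two_nsField''` — KEEP/KILL for the model with `(B)`, `D₁`
  and `A_n` all discharged: remaining hypotheses = host + box data, RESIDENCE (β3), the block weights
  `G₁, G₂, G` with THE CERTIFICATE, `σ² < ∞`, and the eigen / seed data; the comparison `M₁` is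
  stated against `‖⇑x‖²_{−1}`.

Mathlib + the tree files cited; no new definitions (existence statements only).
-/

noncomputable section

namespace Summit.NavierStokesRegularity.FluidComputer.TransportGalerkinBilinearLoss

open Set Filter Topology Finset RCLike
open Literature.Analysis.FunctionSpaces Literature.Analysis.FunctionSpaces.Lattice
open Literature.Analysis.FunctionSpaces.Torus Literature.Analysis.ODE
open Summit.NavierStokesRegularity.FluidComputer.GalerkinLatticePhaseSpace
open Summit.NavierStokesRegularity.FluidComputer.TransportGalerkin
open Summit.NavierStokesRegularity.FluidComputer.TransportGalerkinBox
open Summit.NavierStokesRegularity.FluidComputer.TransportCommutatorLattice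
open Summit.NavierStokesRegularity.FluidComputer.TransportSkewLattice
open Summit.NavierStokesRegularity.FluidComputer.TransportGalerkinRapid
open Summit.NavierStokesRegularity.FluidComputer.TransportGalerkinOneSided
open Summit.NavierStokesRegularity.FluidComputer.TransportGalerkinEmergence
open Summit.NavierStokesRegularity.FluidComputer.TransportGalerkinKeepKill
open Summit.NavierStokesRegularity.FluidComputer.ConvectiveProductLawLattice
open scoped ENNReal NNReal ComplexConjugate InnerProductSpace

variable {d : Type*} [Fintype d] [DecidableEq d]
variable {V : Type*} [NormedAddCommGroup V] [InnerProductSpace ℂ V] [CompleteSpace V]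

/-! ## §1 The diagonal weight `Λ⁻²` on `E` -/

omit [DecidableEq d] [CompleteSpace V] in
/-- `Λ⁻²` of an `ℓ²` family is an `ℓ²` family (its `ofCoeff` has the given coefficients). -/
theorem coe_ofCoeff_wmul_neg_two (z : lp (fun _ : (d → ℤ) => V) 2) :
    ⇑(ofCoeff (wmul (-2) (⇑z))) = wmul (-2) (⇑z) :=
  coe_ofCoeff_of_eNormSq_lt_top (by
    rw [eNormSq_wmul]
    exact (eNormSq_mono (by norm_num) _).trans_lt (eNormSq_zero_coe_lt_top z))

omit [DecidableEq d] [CompleteSpace V] in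
/-- **The diagonal weight `Λ⁻²` exists as a bounded real-linear map on `E`**: `⇑(D z) = Λ⁻² ⇑z`. -/
theorem exists_diagWeight :
    ∃ D : lp (fun _ : (d → ℤ) => V) 2 →L[ℝ] lp (fun _ : (d → ℤ) => V) 2, ∀ z, ⇑(D z) = wmul (-2) (⇑z) := by
  refine ⟨LinearMap.mkContinuous
    { toFun := fun z => ofCoeff (wmul (-2) (⇑z))
      map_add' := fun x y => by
        show ofCoeff (wmul (-2) (⇑(x + y))) = ofCoeff (wmul (-2) ⇑x) + ofCoeff (wmul (-2) ⇑y)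
        refine lp.ext ?_
        rw [coe_ofCoeff_wmul_neg_two (x + y), lp.coeFn_add, lp.coeFn_add, coe_ofCoeff_wmul_neg_two,
          coe_ofCoeff_wmul_neg_two]
        funext k; simp only [wmul_apply, Pi.add_apply, smul_add]
      map_smul' := fun r x => by
        show ofCoeff (wmul (-2) (⇑(r • x))) = r • ofCoeff (wmul (-2) ⇑x)
        refine lp.ext ?_
        rw [coe_ofCoeff_wmul_neg_two (r • x), lp.coeFn_smul, lp.coeFn_smul, coe_ofCoeff_wmul_neg_two]
        funext k
        simp only [wmul_apply, Pi.smul_apply, ← Complex.coe_smul, smul_smul, mul_comm] } 1 fun z => ?_,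
    fun z => coe_ofCoeff_wmul_neg_two z⟩
  -- `‖Λ⁻² z‖ ≤ ‖z‖`
  have h : eNormSq 0 (⇑(ofCoeff (wmul (-2) (⇑z)))) ≤ eNormSq 0 (⇑z) := by
    rw [coe_ofCoeff_wmul_neg_two, eNormSq_wmul]
    exact eNormSq_mono (by norm_num) _
  have h2 := ENNReal.toReal_mono (eNormSq_zero_coe_lt_top z).ne h
  rw [← norm_sq_eq_toReal_eNormSq_zero, ← norm_sq_eq_toReal_eNormSq_zero] at h2
  rw [one_mul]
  exact (pow_le_pow_iff_left₀ (norm_nonneg _) (norm_nonneg _) two_ne_zero).1 h2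

omit [Fintype d] [DecidableEq d] [CompleteSpace V] in
/-- Termwise form of the diagonal pairings: `⟪⟨k⟩⁻²•u, v⟫ = ⟪⟨k⟩⁻¹•u, ⟨k⟩⁻¹•v⟫`. -/
theorem inner_wmul_neg_two_eq [Fintype d] (u v : (d → ℤ) → V) (k : d → ℤ) :
    ⟪wmul (-2) u k, v k⟫_ℂ = ⟪wmul (-1) u k, wmul (-1) v k⟫_ℂ := by
  simp only [wmul_apply, inner_smul_left, inner_smul_right, Complex.conj_ofReal, ← mul_assoc,
    ← Complex.ofReal_mul, ← sobolevWeight_add]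
  norm_num

omit [DecidableEq d] [CompleteSpace V] in
/-- `pairing (Λ⁻² u) v = pairing (Λ⁻¹ u) (Λ⁻¹ v)` (unconditionally). -/
theorem pairing_wmul_neg_two_eq (u v : (d → ℤ) → V) :
    pairing (wmul (-2) u) v = pairing (wmul (-1) u) (wmul (-1) v) := by
  unfold pairing
  exact tsum_congr fun k => inner_wmul_neg_two_eq u v k

omit [DecidableEq d] [CompleteSpace V] in
/-- **`Re⟪Λ⁻² x, x⟫ = ‖⇑x‖²_{−1}`** for `x ∈ E`. -/
theorem re_pairing_wmul_neg_two_self (x : lp (fun _ : (d → ℤ) => V) 2) :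
    (pairing (wmul (-2) (⇑x)) (⇑x)).re = (eNormSq (-1) (⇑x)).toReal := by
  have hfin : eNormSq 0 (wmul (-1) (⇑x)) < ∞ := by
    rw [eNormSq_wmul]
    exact (eNormSq_mono (by norm_num) _).trans_lt (eNormSq_zero_coe_lt_top x)
  rw [pairing_wmul_neg_two_eq, ← toReal_eNormSq_zero_eq_re_pairing hfin, eNormSq_wmul, zero_add]

omit [CompleteSpace V] in
/-- **`P_n`-compatibility of the diagonal weight**: `⟪Λ⁻² w, P_n z⟫ = ⟪Λ⁻² (P_n w), z⟫`. -/
theorem pairing_wmul_neg_two_cubeProj (n : ℕ) (w z : lp (fun _ : (d → ℤ) => V) 2) :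
    pairing (wmul (-2) (⇑w)) (⇑(cubeProj n z)) = pairing (wmul (-2) (⇑(cubeProj n w))) (⇑z) := by
  unfold pairing
  refine tsum_congr fun k => ?_
  rw [cubeProj_apply, wmul_apply, wmul_apply, cubeProj_apply]
  split_ifs
  · rfl
  · rw [inner_zero_right, smul_zero, inner_zero_left]

/-! ## §2 The bilinear loss `(B)` against `Λ⁻²` -/

omit [DecidableEq d] [CompleteSpace V] in
/-- **The product law for the model's bilinearity** (unscaled families): for every `u, v`,
`‖bilCoeff π u v‖₁² ≤ 4σ²·(card d·2π)²·‖u‖₂²·‖v‖₂²`, `σ² = ∑_l ⟨l⟩⁻⁴`. -/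
theorem eNormSq_one_bilCoeff_le {π : d → (V →L[ℂ] ℂ)} (hπ : ∀ j, ‖π j‖ ≤ 1) (u v : (d → ℤ) → V) :
    eNormSq 1 (bilCoeff π u v) ≤ 4 * (∑' l : d → ℤ, ENNReal.ofReal (sobolevWeight (-2) l ^ 2)) *
      ((ENNReal.ofReal ((Fintype.card d : ℝ) * (2 * Real.pi))) ^ 2 * eNormSq 2 u * eNormSq 2 v) := by
  set C : ℝ := (Fintype.card d : ℝ) * (2 * Real.pi) with hC
  have hC0 : 0 ≤ C := by positivity
  -- the scaled advecting family
  have hCe : ‖(C : ℂ)‖ₑ = ENNReal.ofReal C := by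
    rw [← ofReal_norm, Complex.norm_real, Real.norm_of_nonneg hC0]
  have hcv : ∀ m, ‖((C : ℂ) • u m)‖ₑ = ENNReal.ofReal C * ‖u m‖ₑ := fun m => by
    rw [enorm_smul, hCe]
  have hCsplit : ENNReal.ofReal C = (Fintype.card d : ℝ≥0∞) * ENNReal.ofReal (2 * Real.pi) := by
    rw [hC, ENNReal.ofReal_mul (Nat.cast_nonneg _), ENNReal.ofReal_natCast]
  have hdom : ∀ k, ‖bilCoeff π u v k‖ₑ ≤
      ∑' l, ‖(fun m => (C : ℂ) • u m) (k - l)‖ₑ * (ENNReal.ofReal (sobolevWeight 1 l) * ‖v l‖ₑ) := by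
    intro k
    rw [bilCoeff_eq, Pi.neg_apply, enorm_neg]
    refine (enorm_transport_apply_le (fun j p => π j (u p)) u (norm_comp_le π hπ u) v k).trans (le_of_eq ?_)
    rw [← ENNReal.tsum_mul_left]
    refine tsum_congr fun l => ?_
    show _ = ‖(C : ℂ) • u (k - l)‖ₑ * _
    rw [hcv, hCsplit]
    ring
  refine (eNormSq_one_le_of_convective_domination (fun m => (C : ℂ) • u m) v (bilCoeff π u v) hdom).trans
    (le_of_eq ?_)
  rw [show (fun m => (C : ℂ) • u m) = (C : ℂ) • u from rfl, eNormSq_const_smul, hCe]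

variable [ProperSpace V]
variable {ρ : (d → ℤ) → ℝ} {ν : ℝ} {Uv : (d → ℤ) → V} {π : d → (V →L[ℂ] ℂ)} {P : (d → ℤ) → (V →L[ℂ] V)}

omit [DecidableEq d] [CompleteSpace V] [ProperSpace V] in
/-- **`(B)` FOR THE MODEL AGAINST THE DIAGONAL WEIGHT**: for ALL `x, y ∈ E`,
`√Re⟪Λ⁻² (bilOp π P x y), bilOp π P x y⟫ ≤ c_alg ‖x‖ ‖y‖` with
`c_alg = 2·(card d·2π)·√(σ²)`, `σ² = (∑_l ⟨l⟩⁻⁴) < ∞` (junk values are `0`). -/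
theorem bilinear_loss (hπ : ∀ j, ‖π j‖ ≤ 1) (hPn : ∀ k, ‖P k‖ ≤ 1)
    (hσ : ∑' l : d → ℤ, ENNReal.ofReal (sobolevWeight (-2) l ^ 2) < ∞)
    {D : lp (fun _ : (d → ℤ) => V) 2 →L[ℝ] lp (fun _ : (d → ℤ) => V) 2} (hD : ∀ z, ⇑(D z) = wmul (-2) (⇑z))
    (x y : lp (fun _ : (d → ℤ) => V) 2) :
    Real.sqrt (re ⟪D (bilOp π P x y), bilOp π P x y⟫_ℂ) ≤
      2 * ((Fintype.card d : ℝ) * (2 * Real.pi)) *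
        Real.sqrt ((∑' l : d → ℤ, ENNReal.ofReal (sobolevWeight (-2) l ^ 2)).toReal) * ‖x‖ * ‖y‖ := by
  set Sσ := ∑' l : d → ℤ, ENNReal.ofReal (sobolevWeight (-2) l ^ 2) with hSσ
  set C : ℝ := (Fintype.card d : ℝ) * (2 * Real.pi) with hC
  have hC0 : 0 ≤ C := by positivity
  have hrhs : 0 ≤ 2 * C * Real.sqrt Sσ.toReal * ‖x‖ * ‖y‖ := by positivity
  -- the defining family of `bilOp x y`
  set f := wmul 2 (fun k => P k (bilCoeff π (wmul (-2) ⇑x) (wmul (-2) ⇑y) k)) with hf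
  by_cases hmem : Memℓp f 2
  · -- the genuine branch
    have hcoe : ⇑(bilOp π P x y) = f := coe_ofCoeff hmem
    have hre : re ⟪D (bilOp π P x y), bilOp π P x y⟫_ℂ = (eNormSq (-1) f).toReal := by
      rw [show re ⟪D (bilOp π P x y), bilOp π P x y⟫_ℂ = (⟪D (bilOp π P x y), bilOp π P x y⟫_ℂ).re from rfl,
        inner_eq_pairing, hD, hcoe, ← hcoe, re_pairing_wmul_neg_two_self]
    -- `‖f‖²_{-1} = ‖P ∘ bil‖²_{1} ≤ ‖bil‖²_1 ≤ 4σ²C²‖x‖²‖y‖²`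
    have hb : eNormSq (-1) f ≤ 4 * Sσ * (ENNReal.ofReal C ^ 2 * eNormSq 0 (⇑x) * eNormSq 0 (⇑y)) := by
      rw [hf, eNormSq_wmul, show (-1 : ℝ) + 2 = 1 by norm_num]
      refine (eNormSq_apply_le_of_opNorm_le_one P hPn 1 _).trans ?_
      have h := eNormSq_one_bilCoeff_le hπ (wmul (-2) ⇑x) (wmul (-2) ⇑y)
      rw [eNormSq_wmul, eNormSq_wmul, show (2 : ℝ) + -2 = 0 by norm_num] at h
      exact h
    have hfin : 4 * Sσ * (ENNReal.ofReal C ^ 2 * eNormSq 0 (⇑x) * eNormSq 0 (⇑y)) ≠ ∞ :=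
      ENNReal.mul_ne_top (ENNReal.mul_ne_top (by norm_num) hσ.ne) (ENNReal.mul_ne_top
        (ENNReal.mul_ne_top (ENNReal.pow_ne_top ENNReal.ofReal_ne_top) (eNormSq_zero_coe_lt_top x).ne)
        (eNormSq_zero_coe_lt_top y).ne)
    have hreal : re ⟪D (bilOp π P x y), bilOp π P x y⟫_ℂ ≤ (2 * C * Real.sqrt Sσ.toReal * ‖x‖ * ‖y‖) ^ 2 := by
      rw [hre]
      have h := ENNReal.toReal_mono hfin hb
      rw [ENNReal.toReal_mul, ENNReal.toReal_mul, ENNReal.toReal_mul, ENNReal.toReal_mul, ENNReal.toReal_pow,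
        ENNReal.toReal_ofReal hC0, ← norm_sq_eq_toReal_eNormSq_zero, ← norm_sq_eq_toReal_eNormSq_zero,
        show (4 : ℝ≥0∞).toReal = 4 by norm_num] at h
      calc (eNormSq (-1) f).toReal ≤ 4 * Sσ.toReal * (C ^ 2 * ‖x‖ ^ 2 * ‖y‖ ^ 2) := h
        _ = (2 * C * Real.sqrt Sσ.toReal * ‖x‖ * ‖y‖) ^ 2 := by
            rw [show (2 * C * Real.sqrt Sσ.toReal * ‖x‖ * ‖y‖) ^ 2 =
              4 * (Real.sqrt Sσ.toReal) ^ 2 * (C ^ 2 * ‖x‖ ^ 2 * ‖y‖ ^ 2) by ring,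
              Real.sq_sqrt ENNReal.toReal_nonneg]
    calc Real.sqrt (re ⟪D (bilOp π P x y), bilOp π P x y⟫_ℂ)
        ≤ Real.sqrt ((2 * C * Real.sqrt Sσ.toReal * ‖x‖ * ‖y‖) ^ 2) := Real.sqrt_le_sqrt hreal
      _ = 2 * C * Real.sqrt Sσ.toReal * ‖x‖ * ‖y‖ := Real.sqrt_sq hrhs
  · -- the junk branch: `bilOp x y = 0`
    have h0 : bilOp π P x y = 0 := ofCoeff_of_not_memℓp hmem
    rw [h0, inner_zero_right, map_zero, Real.sqrt_zero]
    exact hrhs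

/-! ## §3 KEEP/KILL for the model with `(B)`, `D₁` and `A_n` discharged -/

/-- **KEEP for the transport model — hypotheses = host + box data, residence, the certificate objects
`G₁, G₂, G` with THE CERTIFICATE, `σ² < ∞`, eigen / seed data** (`D₁ = Λ⁻²`, `(B)` by
`bilinear_loss`, `A_n` by `exists_levelGenerators`; `c_alg = 2·(card d·2π)·√σ²`). -/
theorem half_prediction_nsField'' (hν : 0 ≤ ν) (hUv : RapidDecay Uv)
    (hUreal : ∀ j p, π j (Uv (-p)) = conj (π j (Uv p)))
    (hUdiv : ∑ j, freqDeriv j (fun p => π j (Uv p)) = 0) (hπ : ∀ j, ‖π j‖ ≤ 1)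
    (hPsa : ∀ k, IsSelfAdjoint (P k)) (hPn : ∀ k, ‖P k‖ ≤ 1)
    (hρ0 : ∀ k, 0 ≤ ρ k) (hρ1 : Summable fun k => sobolevWeight 1 k * ρ k)
    (hρ2 : Summable fun k => (sobolevWeight 2 k * ρ k) ^ 2)
    {Z : Set (lp (fun _ : (d → ℤ) => V) 2)} {T : ℝ}
    {u : ℕ → lp (fun _ : (d → ℤ) => V) 2 → ℝ → lp (fun _ : (d → ℤ) => V) 2}
    (hT : 0 ≤ T) (hZ : Z ⊆ box ρ π P)
    (sol_continuousOn : ∀ n, ∀ x ∈ Z, ContinuousOn (u n x) (Icc 0 T))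
    (sol_init : ∀ n, ∀ x ∈ Z, u n x 0 = cubeProj n x)
    (sol_hasDerivAt : ∀ n, ∀ x ∈ Z, ∀ t ∈ Ioo 0 T,
      HasDerivAt (u n x) (cubeProj n (nsField ν Uv π P (u n x t))) t)
    (sol_mem : ∀ n, ∀ x ∈ Z, ∀ t ∈ Icc 0 T, u n x t ∈ box ρ π P)
    (sol_proj : ∀ n, ∀ x ∈ Z, ∀ t ∈ Icc 0 T, cubeProj n (u n x t) = u n x t)
    {μ : ℝ}
    (hσ : ∑' l : d → ℤ, ENNReal.ofReal (sobolevWeight (-2) l ^ 2) < ∞)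
    {G₁ G₂ G : lp (fun _ : (d → ℤ) => V) 2 →L[ℝ] lp (fun _ : (d → ℤ) => V) 2}
    (hG₁ : ∀ x y : lp (fun _ : (d → ℤ) => V) 2, ⟪G₁ x, y⟫_ℂ = ⟪x, G₁ y⟫_ℂ)
    (hG₂ : ∀ x y : lp (fun _ : (d → ℤ) => V) 2, ⟪G₂ x, y⟫_ℂ = ⟪x, G₂ y⟫_ℂ)
    (hG : ∀ x y : lp (fun _ : (d → ℤ) => V) 2, ⟪G x, y⟫_ℂ = ⟪x, G y⟫_ℂ)
    (hG₁P : ∀ n, ∀ w z : lp (fun _ : (d → ℤ) => V) 2, ⟪G₁ w, cubeProj n z⟫_ℂ = ⟪G₁ (cubeProj n w), z⟫_ℂ)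
    (hG₂P : ∀ n, ∀ w z : lp (fun _ : (d → ℤ) => V) 2, ⟪G₂ w, cubeProj n z⟫_ℂ = ⟪G₂ (cubeProj n w), z⟫_ℂ)
    (hGP : ∀ n, ∀ w z : lp (fun _ : (d → ℤ) => V) 2, ⟪G w, cubeProj n z⟫_ℂ = ⟪G (cubeProj n w), z⟫_ℂ)
    (hG₁pos : ∀ x : lp (fun _ : (d → ℤ) => V) 2, 0 ≤ re ⟪G₁ x, x⟫_ℂ) {ω c m₂ M₁ : ℝ} (hc : 0 < c)
    (hm₂ : 0 < m₂) (hM₁ : 0 ≤ M₁)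
    (hm₂' : ∀ x : lp (fun _ : (d → ℤ) => V) 2, m₂ * ‖x‖ ^ 2 ≤ re ⟪G₂ x, x⟫_ℂ)
    (hM₁' : ∀ x : lp (fun _ : (d → ℤ) => V) 2, re ⟪G₁ x, x⟫_ℂ ≤ M₁ * (eNormSq (-1) (⇑x)).toReal)
    {m M ω₁ : ℝ} (hm0 : 0 < m) (hm : ∀ x : lp (fun _ : (d → ℤ) => V) 2, m * ‖x‖ ^ 2 ≤ re ⟪G x, x⟫_ℂ)
    (hM : ∀ x : lp (fun _ : (d → ℤ) => V) 2, re ⟪G x, x⟫_ℂ ≤ M * ‖x‖ ^ 2)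
    (h₁ : ∀ n, ∀ w : lp (fun _ : (d → ℤ) => V) 2,
      2 * re ⟪G₁ (cubeProj n w), linOp ν Uv π P (cubeProj n w)⟫_ℂ + c * re ⟪G₂ (cubeProj n w), cubeProj n w⟫_ℂ ≤
        2 * ω * re ⟪G₁ (cubeProj n w), cubeProj n w⟫_ℂ)
    (h₂ : ∀ n, ∀ w : lp (fun _ : (d → ℤ) => V) 2,
      re ⟪G₂ (cubeProj n w), linOp ν Uv π P (cubeProj n w)⟫_ℂ ≤ ω * re ⟪G₂ (cubeProj n w), cubeProj n w⟫_ℂ)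
    (hL : ∀ n, ∀ w : lp (fun _ : (d → ℤ) => V) 2,
      re ⟪G (cubeProj n w), linOp ν Uv π P (cubeProj n w)⟫_ℂ ≤ ω₁ * re ⟪G (cubeProj n w), cubeProj n w⟫_ℂ)
    (hμ₁ : μ ≤ ω₁) (hμ₂ : μ ≤ ω)
    (htail : ∀ n, ∀ q : lp (fun _ : (d → ℤ) => V) 2, cubeProj n q = 0 →
      2 * μ * re ⟪G₁ q, q⟫_ℂ + c * re ⟪G₂ q, q⟫_ℂ ≤ 2 * ω * re ⟪G₁ q, q⟫_ℂ)
    {v : lp (fun _ : (d → ℤ) => V) 2} (hv1 : ‖v‖ = 1) {lam ε : ℝ} (hgap : ω < 2 * lam)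
    (hlam : 0 ≤ lam) (hε : 0 < ε) (hx : ε • v ∈ Z)
    (hres : Tendsto (fun n => ‖cubeProj n (linOp ν Uv π P (cubeProj n v)) - lam • cubeProj n v‖)
      atTop (𝓝 0))
    {C' : ℝ}
    (hCC' : Real.sqrt (M₁ / (c * m₂)) * (2 * ((Fintype.card d : ℝ) * (2 * Real.pi)) *
        Real.sqrt ((∑' l : d → ℤ, ENNReal.ofReal (sobolevWeight (-2) l ^ 2)).toReal)) * Real.sqrt (Real.pi / (2 * lam - ω)) < C')
    (hsmall : ∀ t ∈ Icc 0 T, C' * (3 / 2 : ℝ) ^ 2 * (ε * Real.exp (lam * t)) < 3 / 2 - 1)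
    {w : ℝ → lp (fun _ : (d → ℤ) => V) 2} (hw : ContinuousOn w (Icc 0 T)) (hw0 : w 0 = ε • v)
    (hw' : ∀ t ∈ Ioo 0 T, HasDerivAt w (nsField ν Uv π P (w t)) t) (hwW : ∀ t ∈ Icc 0 T, w t ∈ box ρ π P)
    {t : ℝ} (ht : t ∈ Icc 0 T) (hχ : ε * Real.exp (lam * t) ≤ 2 / (9 * C')) :
    ε * Real.exp (lam * t) / 2 ≤ ‖w t‖ := by
  obtain ⟨D, hD⟩ := exists_diagWeight (d := d) (V := V)
  have hDP : ∀ n, ∀ w z : lp (fun _ : (d → ℤ) => V) 2, ⟪D w, cubeProj n z⟫_ℂ = ⟪D (cubeProj n w), z⟫_ℂ :=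
    fun n w z => by rw [inner_eq_pairing, inner_eq_pairing, hD, hD, pairing_wmul_neg_two_cubeProj]
  have hDre : ∀ x : lp (fun _ : (d → ℤ) => V) 2, re ⟪D x, x⟫_ℂ = (eNormSq (-1) (⇑x)).toReal := fun x => by
    rw [show re ⟪D x, x⟫_ℂ = (⟪D x, x⟫_ℂ).re from rfl, inner_eq_pairing, hD, re_pairing_wmul_neg_two_self]
  have hDnn : ∀ x : lp (fun _ : (d → ℤ) => V) 2, 0 ≤ re ⟪D x, x⟫_ℂ := fun x => by
    rw [hDre]; exact ENNReal.toReal_nonneg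
  have hM₁D : ∀ x : lp (fun _ : (d → ℤ) => V) 2, re ⟪G₁ x, x⟫_ℂ ≤ M₁ * re ⟪D x, x⟫_ℂ := fun x => by
    rw [hDre]; exact hM₁' x
  have hcalg : 0 ≤ 2 * ((Fintype.card d : ℝ) * (2 * Real.pi)) *
      Real.sqrt ((∑' l : d → ℤ, ENNReal.ofReal (sobolevWeight (-2) l ^ 2)).toReal) := by positivity
  exact half_prediction_nsField' hν hUv hUreal hUdiv hπ hPsa hPn hρ0 hρ1 hρ2 hT hZ sol_continuousOn
    sol_init sol_hasDerivAt sol_mem sol_proj hG₁ hG₂ hG hG₁P hG₂P hDP hGP hG₁pos hc hm₂ hM₁ hm₂' hDnn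
    hM₁D hm0 hm hM h₁ h₂ hL hμ₁ hμ₂ htail hcalg (bilinear_loss hπ hPn hσ hD) hv1 hgap hlam hε hx hres
    hCC' hsmall hw hw0 hw' hwW ht hχ

/-- **KILL for the transport model**, same discharges. -/
theorem decay_two_nsField'' (hν : 0 ≤ ν) (hUv : RapidDecay Uv)
    (hUreal : ∀ j p, π j (Uv (-p)) = conj (π j (Uv p)))
    (hUdiv : ∑ j, freqDeriv j (fun p => π j (Uv p)) = 0) (hπ : ∀ j, ‖π j‖ ≤ 1)
    (hPsa : ∀ k, IsSelfAdjoint (P k)) (hPn : ∀ k, ‖P k‖ ≤ 1)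
    (hρ0 : ∀ k, 0 ≤ ρ k) (hρ1 : Summable fun k => sobolevWeight 1 k * ρ k)
    (hρ2 : Summable fun k => (sobolevWeight 2 k * ρ k) ^ 2)
    {Z : Set (lp (fun _ : (d → ℤ) => V) 2)} {T : ℝ}
    {u : ℕ → lp (fun _ : (d → ℤ) => V) 2 → ℝ → lp (fun _ : (d → ℤ) => V) 2}
    (hT : 0 ≤ T) (hZ : Z ⊆ box ρ π P)
    (sol_continuousOn : ∀ n, ∀ x ∈ Z, ContinuousOn (u n x) (Icc 0 T))
    (sol_init : ∀ n, ∀ x ∈ Z, u n x 0 = cubeProj n x)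
    (sol_hasDerivAt : ∀ n, ∀ x ∈ Z, ∀ t ∈ Ioo 0 T,
      HasDerivAt (u n x) (cubeProj n (nsField ν Uv π P (u n x t))) t)
    (sol_mem : ∀ n, ∀ x ∈ Z, ∀ t ∈ Icc 0 T, u n x t ∈ box ρ π P)
    (sol_proj : ∀ n, ∀ x ∈ Z, ∀ t ∈ Icc 0 T, cubeProj n (u n x t) = u n x t)
    {μ : ℝ}
    (hσ : ∑' l : d → ℤ, ENNReal.ofReal (sobolevWeight (-2) l ^ 2) < ∞)
    {G₁ G₂ G : lp (fun _ : (d → ℤ) => V) 2 →L[ℝ] lp (fun _ : (d → ℤ) => V) 2}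
    (hG₁ : ∀ x y : lp (fun _ : (d → ℤ) => V) 2, ⟪G₁ x, y⟫_ℂ = ⟪x, G₁ y⟫_ℂ)
    (hG₂ : ∀ x y : lp (fun _ : (d → ℤ) => V) 2, ⟪G₂ x, y⟫_ℂ = ⟪x, G₂ y⟫_ℂ)
    (hG : ∀ x y : lp (fun _ : (d → ℤ) => V) 2, ⟪G x, y⟫_ℂ = ⟪x, G y⟫_ℂ)
    (hG₁P : ∀ n, ∀ w z : lp (fun _ : (d → ℤ) => V) 2, ⟪G₁ w, cubeProj n z⟫_ℂ = ⟪G₁ (cubeProj n w), z⟫_ℂ)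
    (hG₂P : ∀ n, ∀ w z : lp (fun _ : (d → ℤ) => V) 2, ⟪G₂ w, cubeProj n z⟫_ℂ = ⟪G₂ (cubeProj n w), z⟫_ℂ)
    (hGP : ∀ n, ∀ w z : lp (fun _ : (d → ℤ) => V) 2, ⟪G w, cubeProj n z⟫_ℂ = ⟪G (cubeProj n w), z⟫_ℂ)
    (hG₁pos : ∀ x : lp (fun _ : (d → ℤ) => V) 2, 0 ≤ re ⟪G₁ x, x⟫_ℂ) {ω c m₂ M₁ : ℝ} (hc : 0 < c)
    (hm₂ : 0 < m₂) (hM₁ : 0 ≤ M₁)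
    (hm₂' : ∀ x : lp (fun _ : (d → ℤ) => V) 2, m₂ * ‖x‖ ^ 2 ≤ re ⟪G₂ x, x⟫_ℂ)
    (hM₁' : ∀ x : lp (fun _ : (d → ℤ) => V) 2, re ⟪G₁ x, x⟫_ℂ ≤ M₁ * (eNormSq (-1) (⇑x)).toReal)
    {m M ω₁ : ℝ} (hm0 : 0 < m) (hm : ∀ x : lp (fun _ : (d → ℤ) => V) 2, m * ‖x‖ ^ 2 ≤ re ⟪G x, x⟫_ℂ)
    (hM : ∀ x : lp (fun _ : (d → ℤ) => V) 2, re ⟪G x, x⟫_ℂ ≤ M * ‖x‖ ^ 2)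
    (h₁ : ∀ n, ∀ w : lp (fun _ : (d → ℤ) => V) 2,
      2 * re ⟪G₁ (cubeProj n w), linOp ν Uv π P (cubeProj n w)⟫_ℂ + c * re ⟪G₂ (cubeProj n w), cubeProj n w⟫_ℂ ≤
        2 * ω * re ⟪G₁ (cubeProj n w), cubeProj n w⟫_ℂ)
    (h₂ : ∀ n, ∀ w : lp (fun _ : (d → ℤ) => V) 2,
      re ⟪G₂ (cubeProj n w), linOp ν Uv π P (cubeProj n w)⟫_ℂ ≤ ω * re ⟪G₂ (cubeProj n w), cubeProj n w⟫_ℂ)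
    (hL : ∀ n, ∀ w : lp (fun _ : (d → ℤ) => V) 2,
      re ⟪G (cubeProj n w), linOp ν Uv π P (cubeProj n w)⟫_ℂ ≤ ω₁ * re ⟪G (cubeProj n w), cubeProj n w⟫_ℂ)
    (hμ₁ : μ ≤ ω₁) (hμ₂ : μ ≤ ω)
    (htail : ∀ n, ∀ q : lp (fun _ : (d → ℤ) => V) 2, cubeProj n q = 0 →
      2 * μ * re ⟪G₁ q, q⟫_ℂ + c * re ⟪G₂ q, q⟫_ℂ ≤ 2 * ω * re ⟪G₁ q, q⟫_ℂ)
    {lam : ℝ} (hgap : ω < 2 * lam) (hlam : lam ≤ 0) (hrate : ω₁ ≤ lam)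
    {x : lp (fun _ : (d → ℤ) => V) 2} (hxZ : x ∈ Z) {ε : ℝ} (hε : 0 < ε)
    (hseed : Real.sqrt (M / m) * ‖x‖ < ε)
    (hbasin : 4 * (Real.sqrt (M₁ / (c * m₂)) * (2 * ((Fintype.card d : ℝ) * (2 * Real.pi)) *
        Real.sqrt ((∑' l : d → ℤ, ENNReal.ofReal (sobolevWeight (-2) l ^ 2)).toReal)) * Real.sqrt (Real.pi / (2 * lam - ω))) * ε < 1)
    {w : ℝ → lp (fun _ : (d → ℤ) => V) 2} (hw : ContinuousOn w (Icc 0 T)) (hw0 : w 0 = x)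
    (hw' : ∀ t ∈ Ioo 0 T, HasDerivAt w (nsField ν Uv π P (w t)) t)
    (hwW : ∀ t ∈ Icc 0 T, w t ∈ box ρ π P) :
    ∀ t ∈ Icc 0 T, ‖w t‖ ≤ 2 * (ε * Real.exp (lam * t)) := by
  obtain ⟨D, hD⟩ := exists_diagWeight (d := d) (V := V)
  have hDP : ∀ n, ∀ w z : lp (fun _ : (d → ℤ) => V) 2, ⟪D w, cubeProj n z⟫_ℂ = ⟪D (cubeProj n w), z⟫_ℂ :=
    fun n w z => by rw [inner_eq_pairing, inner_eq_pairing, hD, hD, pairing_wmul_neg_two_cubeProj]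
  have hDre : ∀ x : lp (fun _ : (d → ℤ) => V) 2, re ⟪D x, x⟫_ℂ = (eNormSq (-1) (⇑x)).toReal := fun x => by
    rw [show re ⟪D x, x⟫_ℂ = (⟪D x, x⟫_ℂ).re from rfl, inner_eq_pairing, hD, re_pairing_wmul_neg_two_self]
  have hDnn : ∀ x : lp (fun _ : (d → ℤ) => V) 2, 0 ≤ re ⟪D x, x⟫_ℂ := fun x => by
    rw [hDre]; exact ENNReal.toReal_nonneg
  have hM₁D : ∀ x : lp (fun _ : (d → ℤ) => V) 2, re ⟪G₁ x, x⟫_ℂ ≤ M₁ * re ⟪D x, x⟫_ℂ := fun x => by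
    rw [hDre]; exact hM₁' x
  have hcalg : 0 ≤ 2 * ((Fintype.card d : ℝ) * (2 * Real.pi)) *
      Real.sqrt ((∑' l : d → ℤ, ENNReal.ofReal (sobolevWeight (-2) l ^ 2)).toReal) := by positivity
  exact decay_two_nsField' hν hUv hUreal hUdiv hπ hPsa hPn hρ0 hρ1 hρ2 hT hZ sol_continuousOn
    sol_init sol_hasDerivAt sol_mem sol_proj hG₁ hG₂ hG hG₁P hG₂P hDP hGP hG₁pos hc hm₂ hM₁ hm₂' hDnn
    hM₁D hm0 hm hM h₁ h₂ hL hμ₁ hμ₂ htail hgap hlam hrate hcalg (bilinear_loss hπ hPn hσ hD) hxZ hε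
    hseed hbasin hw hw0 hw' hwW

end Summit.NavierStokesRegularity.FluidComputer.TransportGalerkinBilinearLoss

end
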